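import Summits.BirchSwinnertonDyer.BirchSwinnertonDyer.Theorems.EisensteinPrimesGoodLatticeAnacongFramesRigidity
import Summits.BirchSwinnertonDyer.Rank1Residual.X11b.BDPRouteOpenInputDescent
import HarnessLib

/-!
# The anomalous congruence's conclusion TRANSFERS between frame pairs, and its `∀`-periods form is
# EQUIVALENT to its `∃`-periods form — crux 2 `GoodLatticeBDPValue`, periods-axis of the content stub
# (complement to -w8 g23's `EisensteinPrimesGoodLatticeAnacongFramesRigidity.lean`)

Cell `bsd-eis`, width seat `bsd-line-x1-p1-w2` gen 17, crux 2 (stmt-BirchSwinnertonDyer-19032), line `halves`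
v33N (LEAD g11); helper `--supports`, closes no stub. PROVED, no named fact, no definition, no `sorry`; imports no
`Theses` module. The two pieces of this seat's withdrawn announce (`…GoodLatticeAnacongPeriodTransfer`, STATUS
2026-08-29 20:19:16Z / yield 20:22:23Z / host tie-break 20:22:22Z) that are NOT in -w8 g23's file
`…GoodLatticeAnacongFramesRigidity` (p742986: `FirstUnitCoeffAt` passes between any two `R₀` BDP frames and any two
`R₀` Katz frames; the registered statement `KellerYin2024.thm222_anacong_goodLattice_of_fullDescentDatum` from its
`∃`-frames form), stated ON TOP of it (its §1/§2 theorems are used by name, not restated):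

* `anacong_conclusion_transfer` — for ANY predicate `P n nφ` (in the stub: the `λ`-identity
  `n + Σ_w λ_w(E/K) = 2·nφ + Σ_w (λ_w(θsub) + λ_w(θquot))`, which mentions neither series nor period): across two BDP
  frames of one `(ι, 𝔭, κ, γ, f)` and two Katz frames of one `(ι, v, v̄, C̄, κ, γ, θ_K)` (`p` odd, `θ_K` of finite
  order, all periods non-zero), `(∃ n nφ, FU(L₁,n) ∧ FU(Lφ₁,nφ) ∧ P n nφ) → (∃ n nφ, FU(L₂,n) ∧ FU(Lφ₂,nφ) ∧ P n nφ)`.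
* `forall_frames_iff_exists_frames` — with the content stub's binders VERBATIM (`2 < p`, `Ω_p, Ω_p' ∈ R₀ˣ`,
  `[Fact (κ.IsTopGenerator γ)]`, `IsResidualPairOver WK p θsub θquot`, `IsHeckeCharOf ι θquot θ_K`): AS SOON AS one
  frame of each kind exists (the line's `∃`-shaped print inputs `proofThm422_exists_isBDPLFunction_isTorsion_charIdeal_dvd`
  / `thm513_exists_isBDPLFunction_valueAtOne_disc` and `thm212_exists_isKatzLFunction`, conjuncts of `stub_printInputs`),
  the `∀ (Ω_K, Ω_p, L) (Ω_K', Ω_p', Lφ)`-form of the conclusion `∃ n nφ, FU(L, n) ∧ FU(Lφ, nφ) ∧ P n nφ` is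
  EQUIVALENT to its `∃`-form — both directions, the `⟹` one being instantiation at the given frames.

With p742986 this completes Axis 6 (periods) of the -w2 g15 binder audit (evidence #46) in the kernel: the
universally quantified period binders of the content stub are print-shaped. HONEST FRAMING: bookkeeping over
landed theorems; 0 stubs / cells / labels / tiers move; no summit statement, no case of BSD, no crux or stub,
no Keller–Yin / CGLS / Kriz theorem is proved here.

References: [CastellaGrossiLeeSkinner2022] Thms. 2.1.1, 2.1.2, 2.2.2 with (2.16); [Castella2018] Thm. 3.1;
[Washington1997] §7.1 Prop. 7.2.
-/

noncomputable section

open scoped Classical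

-- `Summit.BirchSwinnertonDyer.BirchSwinnertonDyer.…`: the summit and its single sub-problem share a name (D-0017 layout).
set_option linter.dupNamespace false
set_option autoImplicit false

namespace Summit.BirchSwinnertonDyer.BirchSwinnertonDyer.Theorems.GoodLatticeAnacongFramesTransfer

open NumberField IsDedekindDomain Field Literature.NumberTheory.EllipticCurves
  Literature.NumberTheory.EllipticCurves.CastellaGrossiLeeSkinner2022
  Literature.NumberTheory.EllipticCurves.KellerYin2024 Literature.NumberTheory.GaloisRepresentations
  Summit.BirchSwinnertonDyer.Rank1Residual Summit.BirchSwinnertonDyer.Rank1Residual.X11b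
  Summit.BirchSwinnertonDyer.BirchSwinnertonDyer.Theorems
  Summit.BirchSwinnertonDyer.BirchSwinnertonDyer.Theorems.GoodLatticeAnacongFrames

variable {p : ℕ} [hp : Fact p.Prime] {K : Type} [Field K] [NumberField K] {N : ℕ} {S : Set (PadicAlgCl p)}
  {ι : PadicAlgCl p ≃+* ℂ} {𝔭 v vbar : HeightOneSpectrum (𝓞 K)} {Cbar : Finset (HeightOneSpectrum (𝓞 K))}
  {κ : ZpExtension K p} {γ : absoluteGaloisGroup K} {f : CuspForm (CongruenceSubgroup.Gamma0 N) 2}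
  {θK : HeckeCharacter K}

/-- **TRANSFER of the anomalous congruence's conclusion across period pairs** (abstract `λ`-identity `P`).
`p` odd, `K` imaginary quadratic, `κ` anticyclotomic with topological generator `γ`, `θ_K` of finite order;
BDP frames `(Ω_K₁, Ω_p₁, L₁)`, `(Ω_K₂, Ω_p₂, L₂)` of one `(ι, 𝔭, κ, γ, f)` and Katz frames `(Ω'_K₁, Ω'_p₁, Lφ₁)`,
`(Ω'_K₂, Ω'_p₂, Lφ₂)` of one `(ι, v, v̄, C̄, κ, γ, θ_K)`, all periods non-zero: the statement
`∃ n nφ, FU(L₁, n) ∧ FU(Lφ₁, nφ) ∧ P n nφ` implies `∃ n nφ, FU(L₂, n) ∧ FU(Lφ₂, nφ) ∧ P n nφ` for EVERY predicate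
`P` (same witnesses; -w8 g23's `firstUnitCoeffAt_of_isBDPLFunction_of_isBDPLFunction` and
`firstUnitCoeffAt_of_isKatzLFunction_of_isKatzLFunction`). In `KellerYin2024.thm222_anacong_goodLattice_{…}`, `P n nφ`
is the `λ`-identity `n + Σ_{w ∣ N} λ_w(E/K) = 2·nφ + Σ_{w ∣ N} (λ_w(θsub) + λ_w(θquot))`.
[cite: CastellaGrossiLeeSkinner2022, Thm. 2.2.2 (cor:Kriz) with (2.16)] [cite: Washington1997, §7.1 Prop. 7.2] -/
theorem anacong_conclusion_transfer (hp2 : p ≠ 2) (hK : IsImaginaryQuadratic K) (hκ : κ.IsAnticyclotomic)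
    (hγ : κ.IsTopGenerator γ) (hfin : θK.IsFiniteOrder)
    {ΩK₁ ΩK₂ ΩK'₁ ΩK'₂ : ℂ} {Ωp₁ Ωp₂ Ωp'₁ Ωp'₂ : ℂ_[p]} {L₁ L₂ Lφ₁ Lφ₂ : UnrSeries p}
    (hΩK₁ : ΩK₁ ≠ 0) (hΩK₂ : ΩK₂ ≠ 0) (hΩp₁ : Ωp₁ ≠ 0) (hΩp₂ : Ωp₂ ≠ 0)
    (hΩK'₁ : ΩK'₁ ≠ 0) (hΩK'₂ : ΩK'₂ ≠ 0) (hΩp'₁ : Ωp'₁ ≠ 0) (hΩp'₂ : Ωp'₂ ≠ 0)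
    (hL₁ : IsBDPLFunction ι 𝔭 κ γ f ΩK₁ Ωp₁ L₁) (hL₂ : IsBDPLFunction ι 𝔭 κ γ f ΩK₂ Ωp₂ L₂)
    (hLφ₁ : IsKatzLFunction ι v vbar Cbar κ γ θK ΩK'₁ Ωp'₁ Lφ₁)
    (hLφ₂ : IsKatzLFunction ι v vbar Cbar κ γ θK ΩK'₂ Ωp'₂ Lφ₂) (P : ℕ → ℕ → Prop)
    (h : ∃ n nφ : ℕ, FirstUnitCoeffAt L₁ n ∧ FirstUnitCoeffAt Lφ₁ nφ ∧ P n nφ) :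
    ∃ n nφ : ℕ, FirstUnitCoeffAt L₂ n ∧ FirstUnitCoeffAt Lφ₂ nφ ∧ P n nφ := by
  obtain ⟨n, nφ, hn, hnφ, hP⟩ := h
  exact ⟨n, nφ, firstUnitCoeffAt_of_isBDPLFunction_of_isBDPLFunction hK hκ hγ hΩK₁ hΩK₂ hΩp₁ hΩp₂ hL₁ hL₂ hn,
    firstUnitCoeffAt_of_isKatzLFunction_of_isKatzLFunction hp2 hK hκ hγ hfin hΩK'₁ hΩp'₁ hΩK'₂ hΩp'₂ hLφ₁
      hLφ₂ hnφ, hP⟩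

/-- **`∀`-PERIODS FORM ⟺ `∃`-PERIODS FORM of the anomalous congruence's conclusion**, with the content stub's
binders VERBATIM (`2 < p`; `K` imaginary quadratic; `κ` anticyclotomic, `[Fact (κ.IsTopGenerator γ)]`; a residual
pair `IsResidualPairOver WK p θsub θquot` and `IsHeckeCharOf ι θquot θ_K`; BDP periods `Ω_K ≠ 0`, `Ω_p ∈ R₀ˣ`; Katz
periods `Ω_K' ≠ 0`, `Ω_p' ∈ R₀ˣ`): AS SOON AS one BDP frame of `(ι, 𝔭, κ, γ, f)` and one Katz frame of
`(ι, v, v̄, C̄, κ, γ, θ_K)` exist (the `∃`-shaped print inputs `proofThm422_exists_isBDPLFunction_isTorsion_charIdeal_dvd` /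
`thm513_exists_isBDPLFunction_valueAtOne_disc` and `thm212_exists_isKatzLFunction` — conjuncts of the line's
`stub_printInputs`), the conclusion `∃ n nφ, FU(L, n) ∧ FU(Lφ, nφ) ∧ P n nφ` holds for ALL admissible
`(Ω_K, Ω_p, L)`, `(Ω_K', Ω_p', Lφ)` iff it holds for SOME. (`θ_K` has finite order by -w8 g23's
`isFiniteOrder_of_isHeckeCharOf_of_isResidualPairOver`.) Hence the universally quantified period binders of
`KellerYin2024.thm222_anacong_goodLattice_of_fullDescentDatum` (and of its three siblings) carry exactly print's
content at one period pair: Axis 6 of the binder audit (evidence #46) in the kernel.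
[cite: CastellaGrossiLeeSkinner2022, Thms. 2.1.1, 2.1.2, 2.2.2 with (2.16) (arXiv:2008.02571v2 TeX L1015–1041, L1132–1153)]
[cite: Castella2018, Thm. 3.1] [cite: Washington1997, §7.1 Prop. 7.2, §13.2] -/
theorem forall_frames_iff_exists_frames (hp : 2 < p) (hK : IsImaginaryQuadratic K) (hκ : κ.IsAnticyclotomic)
    [hγ : Fact (κ.IsTopGenerator γ)] {WK : WeierstrassCurve K}
    {θsub θquot : FramedGaloisRep K (padicCoeffIntegers S) 1} (hpair : IsResidualPairOver WK p θsub θquot)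
    (hθK : IsHeckeCharOf ι θquot θK)
    (hexB : ∃ (ΩK : ℂ) (Ωp : (unrIntegers p)ˣ) (L : UnrSeries p), ΩK ≠ 0 ∧
      IsBDPLFunction ι 𝔭 κ γ f ΩK ((Ωp : unrIntegers p) : ℂ_[p]) L)
    (hexK : ∃ (ΩK' : ℂ) (Ωp' : (unrIntegers p)ˣ) (Lφ : UnrSeries p), ΩK' ≠ 0 ∧
      IsKatzLFunction ι v vbar Cbar κ γ θK ΩK' ((Ωp' : unrIntegers p) : ℂ_[p]) Lφ)
    (P : ℕ → ℕ → Prop) :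
    (∀ (ΩK : ℂ) (Ωp : (unrIntegers p)ˣ) (L : UnrSeries p), ΩK ≠ 0 →
        IsBDPLFunction ι 𝔭 κ γ f ΩK ((Ωp : unrIntegers p) : ℂ_[p]) L →
      ∀ (ΩK' : ℂ) (Ωp' : (unrIntegers p)ˣ) (Lφ : UnrSeries p), ΩK' ≠ 0 →
        IsKatzLFunction ι v vbar Cbar κ γ θK ΩK' ((Ωp' : unrIntegers p) : ℂ_[p]) Lφ →
      ∃ n nφ : ℕ, FirstUnitCoeffAt L n ∧ FirstUnitCoeffAt Lφ nφ ∧ P n nφ) ↔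
    (∃ (ΩK : ℂ) (Ωp : (unrIntegers p)ˣ) (L : UnrSeries p), ΩK ≠ 0 ∧
        IsBDPLFunction ι 𝔭 κ γ f ΩK ((Ωp : unrIntegers p) : ℂ_[p]) L ∧
      ∃ (ΩK' : ℂ) (Ωp' : (unrIntegers p)ˣ) (Lφ : UnrSeries p), ΩK' ≠ 0 ∧
        IsKatzLFunction ι v vbar Cbar κ γ θK ΩK' ((Ωp' : unrIntegers p) : ℂ_[p]) Lφ ∧
      ∃ n nφ : ℕ, FirstUnitCoeffAt L n ∧ FirstUnitCoeffAt Lφ nφ ∧ P n nφ) := by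
  have hp2 : p ≠ 2 := by omega
  have hfin : θK.IsFiniteOrder := isFiniteOrder_of_isHeckeCharOf_of_isResidualPairOver S ι hpair hθK
  obtain ⟨ΩK₀, Ωp₀, L₀, hΩK₀, hL₀⟩ := hexB
  obtain ⟨ΩK'₀, Ωp'₀, Lφ₀, hΩK'₀, hLφ₀⟩ := hexK
  refine ⟨fun h ↦ ⟨ΩK₀, Ωp₀, L₀, hΩK₀, hL₀, ΩK'₀, Ωp'₀, Lφ₀, hΩK'₀, hLφ₀,
    h ΩK₀ Ωp₀ L₀ hΩK₀ hL₀ ΩK'₀ Ωp'₀ Lφ₀ hΩK'₀ hLφ₀⟩, fun h ↦ ?_⟩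
  obtain ⟨ΩK₁, Ωp₁, L₁, hΩK₁, hL₁, ΩK'₁, Ωp'₁, Lφ₁, hΩK'₁, hLφ₁, h₁⟩ := h
  intro ΩK Ωp L hΩK hL ΩK' Ωp' Lφ hΩK' hLφ
  exact anacong_conclusion_transfer hp2 hK hκ hγ.out hfin hΩK₁ hΩK (coe_units_unrIntegers_ne_zero Ωp₁)
    (coe_units_unrIntegers_ne_zero Ωp) hΩK'₁ hΩK' (coe_units_unrIntegers_ne_zero Ωp'₁)
    (coe_units_unrIntegers_ne_zero Ωp') hL₁ hL hLφ₁ hLφ P h₁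

/-- **Corollary (the `∀`-form from ONE witnessed frame pair)**, the shape a consumer uses: if SOME BDP frame
`(Ω_K₁, Ω_p₁ ∈ R₀ˣ, L₁)` and SOME Katz frame `(Ω'_K₁, Ω'_p₁ ∈ R₀ˣ, Lφ₁)` satisfy the conclusion, then EVERY admissible
frame pair does (stub binders verbatim). [cite: CastellaGrossiLeeSkinner2022, Thm. 2.2.2 with (2.16)]
[cite: Washington1997, §7.1 Prop. 7.2] -/
theorem forall_frames_of_frames (hp : 2 < p) (hK : IsImaginaryQuadratic K) (hκ : κ.IsAnticyclotomic)
    [hγ : Fact (κ.IsTopGenerator γ)] {WK : WeierstrassCurve K}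
    {θsub θquot : FramedGaloisRep K (padicCoeffIntegers S) 1} (hpair : IsResidualPairOver WK p θsub θquot)
    (hθK : IsHeckeCharOf ι θquot θK) {ΩK₁ ΩK'₁ : ℂ} {Ωp₁ Ωp'₁ : (unrIntegers p)ˣ} {L₁ Lφ₁ : UnrSeries p}
    (hΩK₁ : ΩK₁ ≠ 0) (hL₁ : IsBDPLFunction ι 𝔭 κ γ f ΩK₁ ((Ωp₁ : unrIntegers p) : ℂ_[p]) L₁)
    (hΩK'₁ : ΩK'₁ ≠ 0) (hLφ₁ : IsKatzLFunction ι v vbar Cbar κ γ θK ΩK'₁ ((Ωp'₁ : unrIntegers p) : ℂ_[p]) Lφ₁)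
    (P : ℕ → ℕ → Prop) (h₁ : ∃ n nφ : ℕ, FirstUnitCoeffAt L₁ n ∧ FirstUnitCoeffAt Lφ₁ nφ ∧ P n nφ) :
    ∀ (ΩK : ℂ) (Ωp : (unrIntegers p)ˣ) (L : UnrSeries p), ΩK ≠ 0 →
        IsBDPLFunction ι 𝔭 κ γ f ΩK ((Ωp : unrIntegers p) : ℂ_[p]) L →
      ∀ (ΩK' : ℂ) (Ωp' : (unrIntegers p)ˣ) (Lφ : UnrSeries p), ΩK' ≠ 0 →
        IsKatzLFunction ι v vbar Cbar κ γ θK ΩK' ((Ωp' : unrIntegers p) : ℂ_[p]) Lφ →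
      ∃ n nφ : ℕ, FirstUnitCoeffAt L n ∧ FirstUnitCoeffAt Lφ nφ ∧ P n nφ :=
  (forall_frames_iff_exists_frames hp hK hκ hpair hθK ⟨ΩK₁, Ωp₁, L₁, hΩK₁, hL₁⟩ ⟨ΩK'₁, Ωp'₁, Lφ₁, hΩK'₁, hLφ₁⟩
      P).mpr ⟨ΩK₁, Ωp₁, L₁, hΩK₁, hL₁, ΩK'₁, Ωp'₁, Lφ₁, hΩK'₁, hLφ₁, h₁⟩

end Summit.BirchSwinnertonDyer.BirchSwinnertonDyer.Theorems.GoodLatticeAnacongFramesTransfer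

end
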